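import Mathlib.InformationTheory.Hamming
import Mathlib.Algebra.BigOperators.Fin
import Std.Tactic.BVDecide.LRAT.Checker
import Literature.InformationTheory.QuantumCodes.CSS
import Summits.Ventures.QEC.Census.CNFEncodeSound
import HarnessLib

/-!
# Kernel-B distance certificates, K2 half: the LRAT hook and the bridge to `CSSCode.dX / dZ`

Cell `qec`, PARTITION v2 row type-11 (`Census/LRATBridge.lean`).  Puts together
* Lean core's verified LRAT checker (`Std.Tactic.BVDecide.LRAT.check_sound`: an accepted LRAT proof makes
  a `Std.Sat.CNF Nat` unsatisfiable — the REFUTATION obligation, tier CHECKED-native when discharged by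
  `native_decide`; the KERNEL tier goes through `Census/KernelReplay.lean` instead and also ends in
  `CNF.Unsat`), and
* the ENCODING SOUNDNESS of the Lean `enc-v1` encoder (`CNFEncode.cnfEncode_unsat_imp`),
into statements about binary matrices: for a check matrix `H : Matrix (Fin m) (Fin n) (ZMod 2)` and
logical operators `L : Fin k → (Fin n → ZMod 2)`, if every CNF `Q(H, L_j, w)` (resp. the single CNF
`Q_any(H, L, w)`) built from the SUPPORTS of the rows of `H` and of the `L_j` is unsatisfiable, then every
`v` with `H v = 0` and `⟨L_j, v⟩ = 1` for some `j` has Hamming weight `> w` (`hammingNorm_gt_of_unsat`,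
`hammingNorm_gt_of_unsatAny`).  With the completeness of the logical basis (hypothesis `hlog`: every logical has odd overlap with
some `L_j` — `ParityCheckDuality.css_exists_dotProduct_ne_zero` from a rank certificate) this is
exactly hypothesis `h` of
`Literature.InformationTheory.QuantumCodes.CSSCode.le_dX`, giving `d ≤ dX` (`le_dX_of_unsat`) and the
`Z` twin.

Dictionary (`toAssign`, `support`, `rowSupports`): the vector `v : Fin n → ZMod 2` is the assignment
`i ↦ [v i ≠ 0]` of the coordinate variables; a row / logical `x` is the increasing list of `i` with
`x i ≠ 0`; `⟨x, v⟩ = bz (lparity (toAssign v) (support x))` and `hammingNorm v = weight (toAssign v) n`.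
-/

namespace Summit.Ventures.QEC.Census.LRATBridge

open Std.Sat Std.Tactic.BVDecide Summit.Ventures.QEC.Census.CNFEncode
open Literature.InformationTheory.QuantumCodes Matrix

/-! ## The LRAT hook (REFUTATION ∘ ENCODING) -/

/-- An LRAT proof accepted by Lean core's checker for `cnfEncode n rows u w` excludes every solution of
`Q(H,u,w)`. -/
theorem not_solves_of_lratCheck {n : ℕ} {rows : List (List ℕ)} {u : List ℕ} {w : ℕ}
    (proof : Array LRAT.IntAction) (h : LRAT.check proof (cnfEncode n rows u w) = true)
    (hrows : ∀ r ∈ rows, ∀ i ∈ r, i < n) (hu : ∀ i ∈ u, i < n) (a : ℕ → Bool) :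
    ¬ Solves n rows u w a :=
  fun ha => cnfEncode_unsat_imp hrows hu (LRAT.check_sound proof _ h) ⟨a, ha⟩

/-- `Q_any` version of `not_solves_of_lratCheck`. -/
theorem not_solvesAny_of_lratCheck {n : ℕ} {rows : List (List ℕ)} {us : List (List ℕ)} {w : ℕ}
    (proof : Array LRAT.IntAction) (h : LRAT.check proof (cnfEncodeAny n rows us w) = true)
    (hrows : ∀ r ∈ rows, ∀ i ∈ r, i < n) (hus : ∀ u ∈ us, ∀ i ∈ u, i < n) (a : ℕ → Bool) :
    ¬ SolvesAny n rows us w a :=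
  fun ha => cnfEncodeAny_unsat_imp hrows hus (LRAT.check_sound proof _ h) ⟨a, ha⟩

/-! ## Dictionary: `𝔽₂`-vectors ↔ Boolean assignments and support lists -/

/-- `Bool ↪ ZMod 2`. -/
def bz (b : Bool) : ZMod 2 := if b then 1 else 0

/-- The Boolean assignment of the coordinate variables determined by `v : 𝔽₂ⁿ` (`false` beyond `n`). -/
def toAssign {n : ℕ} (v : Fin n → ZMod 2) : ℕ → Bool :=
  fun i => if h : i < n then decide (v ⟨i, h⟩ ≠ 0) else false

/-- The support of `x : 𝔽₂ⁿ` as the increasing list of coordinates `i` with `x i ≠ 0`. -/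
def support {n : ℕ} (x : Fin n → ZMod 2) : List ℕ :=
  ((List.finRange n).filter fun i => x i ≠ 0).map Fin.val

/-- The row supports of a check matrix, in row order. -/
def rowSupports {m n : ℕ} (H : Matrix (Fin m) (Fin n) (ZMod 2)) : List (List ℕ) :=
  (List.finRange m).map fun r => support (H r)

/-- The supports of a family of logical operators, in index order. -/
def supports {k n : ℕ} (L : Fin k → Fin n → ZMod 2) : List (List ℕ) :=
  (List.finRange k).map fun j => support (L j)

/-- Support coordinates are `< n`. -/
theorem support_lt {n : ℕ} (x : Fin n → ZMod 2) : ∀ i ∈ support x, i < n := by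
  intro i hi
  simp only [support, List.mem_map, List.mem_filter] at hi
  obtain ⟨j, -, rfl⟩ := hi; exact j.isLt

/-- Row-support coordinates are `< n`. -/
theorem rowSupports_lt {m n : ℕ} (H : Matrix (Fin m) (Fin n) (ZMod 2)) :
    ∀ r ∈ rowSupports H, ∀ i ∈ r, i < n := by
  intro r hr
  simp only [rowSupports, List.mem_map] at hr
  obtain ⟨j, -, rfl⟩ := hr; exact support_lt _

/-- Logical-support coordinates are `< n`. -/
theorem supports_lt {k n : ℕ} (L : Fin k → Fin n → ZMod 2) :
    ∀ u ∈ supports L, ∀ i ∈ u, i < n := by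
  intro u hu
  simp only [supports, List.mem_map] at hu
  obtain ⟨j, -, rfl⟩ := hu; exact support_lt _

/-- Value of `toAssign v` at a coordinate. -/
theorem toAssign_val {n : ℕ} (v : Fin n → ZMod 2) (i : Fin n) : toAssign v i.val = decide (v i ≠ 0) := by
  simp [toAssign, i.isLt]

/-- `bz` turns `xor` into addition in `ZMod 2`. -/
theorem bz_xor (p q : Bool) : bz (xor p q) = bz p + bz q := by
  cases p <;> cases q <;> decide

/-- `bz` of a list parity is the `ZMod 2` sum. -/
theorem bz_lparity (a : ℕ → Bool) (L : List ℕ) : bz (lparity a L) = (L.map fun i => bz (a i)).sum := by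
  induction L with
  | nil => rfl
  | cons x L ih => simp [lparity, bz_xor, ih]

/-- `[z ≠ 0]` read back in `ZMod 2` is `z`. -/
theorem bz_decide_ne_zero (z : ZMod 2) : bz (decide (z ≠ 0)) = z := by
  fin_cases z <;> decide

/-- Multiplication in `ZMod 2` as a conditional. -/
theorem zmod2_mul_eq_ite (z w : ZMod 2) : z * w = if z ≠ 0 then w else 0 := by
  fin_cases z <;> fin_cases w <;> decide

/-- Sum over a filtered list as a sum of conditionals. -/
theorem sum_map_filter_eq {α β : Type*} [AddCommMonoid β] (L : List α) (p : α → Prop) [DecidablePred p]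
    (f : α → β) : ((L.filter fun a => p a).map f).sum = (L.map fun a => if p a then f a else 0).sum := by
  induction L with
  | nil => simp
  | cons a L ih =>
    by_cases h : p a
    · simp [h, ih]
    · simp [h, ih]

/-- **Parity dictionary**: `⟨x, v⟩ = bz (parity of v over the support of x)`. -/
theorem bz_lparity_support {n : ℕ} (x v : Fin n → ZMod 2) :
    bz (lparity (toAssign v) (support x)) = x ⬝ᵥ v := by
  rw [bz_lparity, support, List.map_map]
  have h1 : ((List.finRange n).filter fun i => x i ≠ 0).map ((fun i => bz (toAssign v i)) ∘ Fin.val) =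
      ((List.finRange n).filter fun i => x i ≠ 0).map v := by
    apply List.map_congr_left
    intro i _
    simp only [Function.comp, toAssign_val, bz_decide_ne_zero]
  rw [h1, sum_map_filter_eq, dotProduct, Fin.sum_univ_def]
  congr 1
  apply List.map_congr_left
  intro i _
  rw [zmod2_mul_eq_ite]

/-- `⟨x, v⟩ = 0 ↔` even parity. -/
theorem lparity_support_eq_false_iff {n : ℕ} (x v : Fin n → ZMod 2) :
    lparity (toAssign v) (support x) = false ↔ x ⬝ᵥ v = 0 := by
  rw [← bz_lparity_support]
  cases lparity (toAssign v) (support x) <;> simp [bz]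

/-- `⟨x, v⟩ ≠ 0 ↔` odd parity. -/
theorem lparity_support_eq_true_iff {n : ℕ} (x v : Fin n → ZMod 2) :
    lparity (toAssign v) (support x) = true ↔ x ⬝ᵥ v ≠ 0 := by
  rw [← bz_lparity_support]
  cases lparity (toAssign v) (support x) <;> simp [bz]

/-- **Weight dictionary**: the encoder's `weight` of the assignment is the Hamming weight. -/
theorem weight_toAssign {n : ℕ} (v : Fin n → ZMod 2) : weight (toAssign v) n = hammingNorm v := by
  have h1 : ∀ N : ℕ, ∀ a : ℕ → Bool, pcount a N = ∑ i : Fin N, (if a i.val then 1 else 0) := by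
    intro N a
    induction N with
    | zero => simp [pcount]
    | succ N ih => rw [pcount_succ, Fin.sum_univ_castSucc, ih]; rfl
  rw [← pcount_eq_weight, h1, hammingNorm, Finset.card_filter]
  refine Finset.sum_congr rfl fun i _ => ?_
  rw [toAssign_val]
  by_cases h : v i ≠ 0 <;> simp [h]

/-- **Rows dictionary**: all row supports even `↔ H v = 0`. -/
theorem rows_even_iff {m n : ℕ} (H : Matrix (Fin m) (Fin n) (ZMod 2)) (v : Fin n → ZMod 2) :
    (∀ r ∈ rowSupports H, lparity (toAssign v) r = false) ↔ H *ᵥ v = 0 := by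
  constructor
  · intro h
    funext r
    have := h (support (H r)) (by simp [rowSupports])
    rw [lparity_support_eq_false_iff] at this
    exact this
  · intro h r hr
    simp only [rowSupports, List.mem_map] at hr
    obtain ⟨j, -, rfl⟩ := hr
    rw [lparity_support_eq_false_iff]
    have := congrFun h j
    exact this

/-- A low-weight vector in `ker H` with odd overlap with `x` IS a solution of `Q(H, x, w)`. -/
theorem solves_of_vector {m n w : ℕ} (H : Matrix (Fin m) (Fin n) (ZMod 2)) (x v : Fin n → ZMod 2)
    (hv : H *ᵥ v = 0) (hx : x ⬝ᵥ v ≠ 0) (hw : hammingNorm v ≤ w) :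
    Solves n (rowSupports H) (support x) w (toAssign v) :=
  ⟨(rows_even_iff H v).2 hv, (lparity_support_eq_true_iff x v).2 hx, by rwa [weight_toAssign]⟩

/-- … and a solution of `Q_any(H, L, w)` when the odd overlap is with some `L_j`. -/
theorem solvesAny_of_vector {m n k w : ℕ} (H : Matrix (Fin m) (Fin n) (ZMod 2))
    (L : Fin k → Fin n → ZMod 2) (v : Fin n → ZMod 2) (hv : H *ᵥ v = 0) (hx : ∃ j, L j ⬝ᵥ v ≠ 0)
    (hw : hammingNorm v ≤ w) : SolvesAny n (rowSupports H) (supports L) w (toAssign v) := by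
  obtain ⟨j, hj⟩ := hx
  exact ⟨(rows_even_iff H v).2 hv,
    ⟨support (L j), by simp [supports], (lparity_support_eq_true_iff _ v).2 hj⟩,
    by rwa [weight_toAssign]⟩

/-! ## Lower bounds from UNSAT verdicts -/

/-- **K2 lower bound, per-logical pieces** (`enc-v1` scheme `logical`): if every `Q(H, L_j, w)` is
unsatisfiable then every `v ∈ ker H` with `⟨L_j, v⟩ ≠ 0` for some `j` has weight `> w`.  The CNF data
`rows` / `us j` are literal lists tied to the matrices by the equations `hrows` / `hus` (proved per
instance by `decide`), so that replaying certificates never evaluates matrices. -/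
theorem hammingNorm_gt_of_unsat {m n k w : ℕ} (H : Matrix (Fin m) (Fin n) (ZMod 2))
    (L : Fin k → Fin n → ZMod 2) (rows : List (List ℕ)) (us : Fin k → List ℕ)
    (hrows : rowSupports H = rows) (hus : ∀ j, support (L j) = us j)
    (hunsat : ∀ j, (cnfEncode n rows (us j) w).Unsat)
    (v : Fin n → ZMod 2) (hv : H *ᵥ v = 0) (hx : ∃ j, L j ⬝ᵥ v ≠ 0) : w < hammingNorm v := by
  obtain ⟨j, hj⟩ := hx
  subst hrows
  by_contra hle
  exact cnfEncode_unsat_imp (rowSupports_lt H) ((hus j) ▸ support_lt (L j)) (hunsat j)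
    ⟨toAssign v, (hus j) ▸ solves_of_vector H (L j) v hv hj (Nat.le_of_not_lt hle)⟩

/-- **K2 lower bound, single `Q_any` CNF**: if `Q_any(H, L, w)` is unsatisfiable then every `v ∈ ker H`
with some `⟨L_j, v⟩ ≠ 0` has weight `> w`. -/
theorem hammingNorm_gt_of_unsatAny {m n k w : ℕ} (H : Matrix (Fin m) (Fin n) (ZMod 2))
    (L : Fin k → Fin n → ZMod 2) (rows us : List (List ℕ)) (hrows : rowSupports H = rows)
    (hus : supports L = us) (hunsat : (cnfEncodeAny n rows us w).Unsat)
    (v : Fin n → ZMod 2) (hv : H *ᵥ v = 0) (hx : ∃ j, L j ⬝ᵥ v ≠ 0) : w < hammingNorm v := by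
  subst hrows hus
  by_contra hle
  exact cnfEncodeAny_unsat_imp (rowSupports_lt H) (supports_lt L) hunsat
    ⟨toAssign v, solvesAny_of_vector H L v hv hx (Nat.le_of_not_lt hle)⟩

/-! ## Assembly with the CSS distance (`CSSCode.le_dX`) -/

/-- **`d ≤ d^X` from kernel-B verdicts.**  For a CSS code on `n` qubits with `Z`-logicals `LZ_j`
entering through `hlog : every X-logical (H^Z v = 0, v ∉ rs H^X) has ⟨LZ_j, v⟩ ≠ 0 for some j` — the
COMPLETENESS of the logical basis, = `css_exists_dotProduct_ne_zero` of `ParityCheckDuality.lean`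
applied to `ker H^Z ≤ rs H^X ⊔ span LZ` (a rank certificate): if every `Q(H^Z, LZ_j, d-1)` is UNSAT
then every `X`-logical has weight `≥ d`, so `d ≤ d^X` (some `X`-logical existing, `hex`, guards the
junk value of `dX`). -/
theorem le_dX_of_unsat {mX mZ n k : ℕ} (C : CSSCode (Fin mX) (Fin mZ) (Fin n))
    (LZ : Fin k → Fin n → ZMod 2) (d : ℕ) (rows : List (List ℕ)) (us : Fin k → List ℕ)
    (hrows : rowSupports C.HZ = rows) (hus : ∀ j, support (LZ j) = us j)
    (hunsat : ∀ j, (cnfEncode n rows (us j) (d - 1)).Unsat)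
    (hlog : ∀ v : Fin n → ZMod 2, C.HZ *ᵥ v = 0 → v ∉ C.rowSpX → ∃ j, LZ j ⬝ᵥ v ≠ 0)
    (hex : ∃ v : Fin n → ZMod 2, C.HZ *ᵥ v = 0 ∧ v ∉ C.rowSpX) : d ≤ C.dX := by
  refine C.le_dX hex fun v hv hv' => ?_
  have := hammingNorm_gt_of_unsat C.HZ LZ rows us hrows hus hunsat v hv (hlog v hv hv')
  omega

/-- `Q_any` form of `le_dX_of_unsat` (one CNF per side; the base CNF of the `enc-v2` leaves). -/
theorem le_dX_of_unsatAny {mX mZ n k : ℕ} (C : CSSCode (Fin mX) (Fin mZ) (Fin n))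
    (LZ : Fin k → Fin n → ZMod 2) (d : ℕ) (rows us : List (List ℕ))
    (hrows : rowSupports C.HZ = rows) (hus : supports LZ = us)
    (hunsat : (cnfEncodeAny n rows us (d - 1)).Unsat)
    (hlog : ∀ v : Fin n → ZMod 2, C.HZ *ᵥ v = 0 → v ∉ C.rowSpX → ∃ j, LZ j ⬝ᵥ v ≠ 0)
    (hex : ∃ v : Fin n → ZMod 2, C.HZ *ᵥ v = 0 ∧ v ∉ C.rowSpX) : d ≤ C.dX := by
  refine C.le_dX hex fun v hv hv' => ?_
  have := hammingNorm_gt_of_unsatAny C.HZ LZ rows us hrows hus hunsat v hv (hlog v hv hv')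
  omega

/-- **`d ≤ d^Z`** (the `X ↔ Z` exchange of `le_dX_of_unsat`): `X`-logicals `LX_j`, CNFs `Q(H^X, LX_j, d-1)`,
completeness `ker H^X ∩ LX^⊥ ⊆ rs H^Z`. -/
theorem le_dZ_of_unsat {mX mZ n k : ℕ} (C : CSSCode (Fin mX) (Fin mZ) (Fin n))
    (LX : Fin k → Fin n → ZMod 2) (d : ℕ) (rows : List (List ℕ)) (us : Fin k → List ℕ)
    (hrows : rowSupports C.HX = rows) (hus : ∀ j, support (LX j) = us j)
    (hunsat : ∀ j, (cnfEncode n rows (us j) (d - 1)).Unsat)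
    (hlog : ∀ v : Fin n → ZMod 2, C.HX *ᵥ v = 0 → v ∉ C.rowSpZ → ∃ j, LX j ⬝ᵥ v ≠ 0)
    (hex : ∃ v : Fin n → ZMod 2, C.HX *ᵥ v = 0 ∧ v ∉ C.rowSpZ) : d ≤ C.dZ :=
  le_dX_of_unsat C.swap LX d rows us hrows hus hunsat hlog hex

/-- `Q_any` form of `le_dZ_of_unsat`. -/
theorem le_dZ_of_unsatAny {mX mZ n k : ℕ} (C : CSSCode (Fin mX) (Fin mZ) (Fin n))
    (LX : Fin k → Fin n → ZMod 2) (d : ℕ) (rows us : List (List ℕ))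
    (hrows : rowSupports C.HX = rows) (hus : supports LX = us)
    (hunsat : (cnfEncodeAny n rows us (d - 1)).Unsat)
    (hlog : ∀ v : Fin n → ZMod 2, C.HX *ᵥ v = 0 → v ∉ C.rowSpZ → ∃ j, LX j ⬝ᵥ v ≠ 0)
    (hex : ∃ v : Fin n → ZMod 2, C.HX *ᵥ v = 0 ∧ v ∉ C.rowSpZ) : d ≤ C.dZ :=
  le_dX_of_unsatAny C.swap LX d rows us hrows hus hunsat hlog hex

end Summit.Ventures.QEC.Census.LRATBridge
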